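import Literature.Order.Ordinal.NaturalSumCantorNormalForm
import HarnessLib

/-!
# The upper bound `α ⊕ β ≤ αβ + βα` for non-zero ordinals (Clark 2015, §1.2, Prop. 4 (b), corrected)

Topic `Literature/Order/Ordinal`, namespace `Literature.Order.Ordinal`.  THEOREMS ONLY (no `def`, no instance, no named
fact), all proved, on top of `NaturalSumCantorNormalForm.lean` (Clark's Thm. 3: the block formula
`nadd_opow_mul_natCast_add`, absorption `nadd_opow_mul_natCast_add_of_lt`, and `⊕`-closedness of `ω^γ`,
`isPrincipal_nadd_omega0_opow`).

## Source (read at the page) and the correction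

P. L. Clark, *A note on Euclidean order types*, Order **32** (2015) [Clark2015EuclideanOrderTypes] (materialised
`paper:arxiv-1208.0977`, p0003), §1.2, VERBATIM: «**Proposition 4.** Let `α, β ∈ Ord`. a) If `β < ω`, then
`α + β = α ⊕ β`. b) In general we have `max(α + β, β + α) ≤ α ⊕ β ≤ αβ + βα`. Proof. Left to the reader.»
Part a) and the lower bound of b) are in `NaturalSum.lean` (`nadd_eq_add_of_lt_omega0`, `max_add_le_nadd`).  AS PRINTED
THE UPPER BOUND FAILS when exactly one of `α, β` is `0`: `α ⊕ 0 = α > 0 = α·0 + 0·α` for `α ≠ 0`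
(`mul_add_mul_lt_nadd_zero` below); it holds — and is proved here — for `α, β ≥ 1` (and trivially for `α = β = 0`).
The tree's `NaturalSum.lean` records exactly this: «TODO(general form): Prop. 4 (b)'s upper bound `α ⊕ β ≤ αβ + βα` is not
formalised (as printed it fails for `β = 0 < α` …; it needs `α, β ≥ 1`)» — resolved by this file.

## What is formalised

* `exists_eq_opow_log_mul_natCast_add` — the leading block of the Cantor normal form: a non-zero `α` is
  `ω^{log_ω α}·a + x` with `1 ≤ a < ω` and `x < ω^{log_ω α}`.
* `nadd_lt_opow_succ_log` — `α, β ≤ μ ≠ 0 ⟹ α ⊕ β < ω^{log_ω μ + 1}` (the natural sum does not raise the leading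
  exponent; from the `⊕`-closedness of `ω^γ`).
* `nadd_lt_self_add_self_of_lt_opow_log` — if `β < ω^{log_ω α}` (all exponents of `β` are below the leading exponent of
  `α`), then `α ⊕ β < α + α` (absorption: `α ⊕ β = ω^γ·a + (x ⊕ β) < ω^γ·(a + 1) ≤ α + α`).
* **`nadd_le_mul_add_mul`** — PROP. 4 (b), UPPER BOUND, CORRECTED: `0 < α`, `0 < β ⟹ α ⊕ β ≤ αβ + βα`
  (leading exponents `γ = log_ω α`, `δ = log_ω β`: if `δ < γ` then `α ⊕ β < α + α ≤ αβ + βα`; symmetrically if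
  `γ < δ`; if `γ = δ ≥ 1` then `α ⊕ β < ω^{γ+1} ≤ ω^γ·ω^γ ≤ αβ`; if `γ = δ = 0` both are positive integers and
  `m + n ≤ mn + nm`).
* `mul_add_mul_lt_nadd_zero` — the witness that the printed form needs `β ≠ 0`.

## Mathlib / tree search

Mathlib: `Ordinal.log`, `Ordinal.opow_log_le_self`, `Ordinal.lt_opow_succ_log_self`, `Ordinal.div_opow_log_lt`,
`Ordinal.lt_opow_iff_log_lt`, `Ordinal.div_add_mod`, `Ordinal.mod_lt`, `Ordinal.le_mul_left/right`, `mul_le_mul'`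
(`Ordinal.mulLeftMono/mulRightMono`), `Ordinal.natCast_mul`; no `Ordinal.nadd` at this pin.  Tree: `NaturalSum.lean`
(`nadd_comm`, `nadd_natCast_natCast`, `nadd_zero`, `nadd_le_nadd`), `NaturalSumCantorNormalForm.lean` (as above).
-/

namespace Literature.Order.Ordinal

open _root_.Ordinal _root_.Order

universe u

/-- **The leading block of the Cantor normal form**: a non-zero ordinal is `α = ω^{log_ω α}·a + x` with `1 ≤ a < ω`
(`a = α / ω^{log_ω α}`) and `x = α % ω^{log_ω α} < ω^{log_ω α}`.
[cite: Clark2015EuclideanOrderTypes, §1.2 («a version of the Cantor normal form»)] -/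
theorem exists_eq_opow_log_mul_natCast_add {α : Ordinal.{u}} (hα : α ≠ 0) :
    ∃ a : ℕ, 1 ≤ a ∧ ∃ x < ω ^ log ω α, α = ω ^ log ω α * a + x := by
  have h0 : (ω : Ordinal.{u}) ^ log ω α ≠ 0 := (opow_pos _ omega0_pos).ne'
  obtain ⟨a, ha⟩ := Ordinal.lt_omega0.1 (div_opow_log_lt α one_lt_omega0)
  refine ⟨a, ?_, α % ω ^ log ω α, Ordinal.mod_lt α h0, ?_⟩
  · have hpos : 0 < α / ω ^ log ω α := div_opow_log_pos ω hα
    rw [ha] at hpos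
    exact_mod_cast Order.one_le_iff_ne_zero.2 hpos.ne'
  · rw [← ha, Ordinal.div_add_mod]

/-- **The natural sum does not raise the leading exponent**: if `α, β ≤ μ` with `μ ≠ 0`, then
`α ⊕ β < ω^{log_ω μ + 1}` (both lie below `ω^{log_ω μ + 1}`, which is `⊕`-closed).
[cite: Clark2015EuclideanOrderTypes, §1.2 Thm. 3 (consequence)] -/
theorem nadd_lt_opow_succ_log {α β μ : Ordinal.{u}} (hα : α ≤ μ) (hβ : β ≤ μ) :
    nadd α β < ω ^ (log ω μ + 1) := by
  have hμ : μ < ω ^ (log ω μ + 1) := by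
    rw [← succ_eq_add_one]; exact lt_opow_succ_log_self one_lt_omega0 μ
  exact isPrincipal_nadd_omega0_opow _ (hα.trans_lt hμ) (hβ.trans_lt hμ)

/-- **Absorption bound**: if every exponent of `β` lies below the leading exponent of `α ≠ 0`, i.e. `β < ω^{log_ω α}`,
then `α ⊕ β < α + α`: with `α = ω^γ·a + x`, `α ⊕ β = ω^γ·a + (x ⊕ β) < ω^γ·a + ω^γ = ω^γ·(a + 1) ≤ ω^γ·a + ω^γ·a ≤ α + α`.
[cite: Clark2015EuclideanOrderTypes, §1.2 Prop. 4 (b) (upper bound, proof step)] -/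
theorem nadd_lt_self_add_self_of_lt_opow_log {α β : Ordinal.{u}} (hα : α ≠ 0) (hβ : β < ω ^ log ω α) :
    nadd α β < α + α := by
  obtain ⟨a, ha1, x, hx, hαeq⟩ := exists_eq_opow_log_mul_natCast_add hα
  set γ := log ω α with hγ
  have hblock : ω ^ γ * (a : Ordinal.{u}) ≤ α := by
    conv_rhs => rw [hαeq]
    exact le_self_add
  have hωγ : (ω : Ordinal.{u}) ^ γ ≤ ω ^ γ * (a : Ordinal.{u}) := by
    conv_lhs => rw [← mul_one (ω ^ γ)]
    exact mul_le_mul_right (by exact_mod_cast ha1) _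
  calc nadd α β = ω ^ γ * (a : Ordinal.{u}) + nadd x β := by
        conv_lhs => rw [hαeq]
        exact nadd_opow_mul_natCast_add_of_lt γ a hx hβ
    _ < ω ^ γ * (a : Ordinal.{u}) + ω ^ γ := (add_lt_add_iff_left _).2 (nadd_lt_omega0_opow hx hβ)
    _ ≤ α + α := add_le_add hblock (hωγ.trans hblock)

/-- **Proposition 4 (b), upper bound — corrected: for non-zero ordinals `α, β`, `α ⊕ β ≤ αβ + βα`.**  (As printed,
«in general», it fails for `β = 0 < α`, see `mul_add_mul_lt_nadd_zero`.)  Proof by the leading exponents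
`γ = log_ω α`, `δ = log_ω β`: if `δ < γ`, `α ⊕ β < α + α ≤ αβ + βα` (`α ≤ αβ`, `α ≤ βα` as `β ≥ 1`); if `γ < δ`,
symmetrically `α ⊕ β < β + β ≤ αβ + βα`; if `γ = δ ≥ 1`, `α ⊕ β < ω^{γ+1} ≤ ω^{γ+γ} = ω^γ·ω^γ ≤ αβ`; if `γ = δ = 0`,
`α = m`, `β = n` are positive integers and `m ⊕ n = m + n ≤ mn + nm`.
[cite: Clark2015EuclideanOrderTypes, §1.2 Prop. 4 (b) (upper bound; hypothesis α, β ≠ 0 added)] -/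
theorem nadd_le_mul_add_mul {α β : Ordinal.{u}} (hα : 0 < α) (hβ : 0 < β) : nadd α β ≤ α * β + β * α := by
  have hα0 : α ≠ 0 := hα.ne'
  have hβ0 : β ≠ 0 := hβ.ne'
  rcases lt_trichotomy (log ω β) (log ω α) with hlt | heq | hgt
  · -- `δ < γ`: absorption
    have hβ' : β < ω ^ log ω α := (lt_opow_iff_log_lt one_lt_omega0 hβ0).2 hlt
    exact (nadd_lt_self_add_self_of_lt_opow_log hα0 hβ').le.trans
      (add_le_add (le_mul_left α hβ) (le_mul_right α hβ))
  · rcases eq_or_ne (log ω α) 0 with hγ0 | hγ0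
    · -- both finite: positive integers
      have hαω : α < ω := by
        have h := lt_opow_succ_log_self one_lt_omega0 α
        rwa [hγ0, succ_eq_add_one, zero_add, opow_one] at h
      have hβω : β < ω := by
        have h := lt_opow_succ_log_self one_lt_omega0 β
        rwa [heq, hγ0, succ_eq_add_one, zero_add, opow_one] at h
      obtain ⟨m, rfl⟩ := Ordinal.lt_omega0.1 hαω
      obtain ⟨n, rfl⟩ := Ordinal.lt_omega0.1 hβω
      have hm : 1 ≤ m := by exact_mod_cast Order.one_le_iff_ne_zero.2 hα0
      have hn : 1 ≤ n := by exact_mod_cast Order.one_le_iff_ne_zero.2 hβ0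
      rw [nadd_natCast_natCast, ← natCast_mul, ← natCast_mul, ← Nat.cast_add]
      exact_mod_cast Nat.add_le_add (Nat.le_mul_of_pos_right m hn) (Nat.le_mul_of_pos_right n hm)
    · -- `γ = δ ≥ 1`
      have hγ1 : 1 ≤ log ω α := Order.one_le_iff_ne_zero.2 hγ0
      have hαlt : α < ω ^ (log ω α + 1) := by
        rw [← succ_eq_add_one]; exact lt_opow_succ_log_self one_lt_omega0 α
      have hβlt : β < ω ^ (log ω α + 1) := by
        rw [← heq, ← succ_eq_add_one]; exact lt_opow_succ_log_self one_lt_omega0 β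
      calc nadd α β ≤ ω ^ (log ω α + 1) := (isPrincipal_nadd_omega0_opow _ hαlt hβlt).le
        _ ≤ ω ^ (log ω α + log ω α) := opow_le_opow_right omega0_pos ((add_le_add_iff_left _).2 hγ1)
        _ = ω ^ log ω α * ω ^ log ω β := by rw [opow_add, heq]
        _ ≤ α * β := mul_le_mul' (opow_log_le_self ω hα0) (opow_log_le_self ω hβ0)
        _ ≤ α * β + β * α := le_self_add
  · -- `γ < δ`: absorption, symmetric
    have hα' : α < ω ^ log ω β := (lt_opow_iff_log_lt one_lt_omega0 hα0).2 hgt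
    rw [nadd_comm]
    exact (nadd_lt_self_add_self_of_lt_opow_log hβ0 hα').le.trans
      (add_le_add (le_mul_right β hα) (le_mul_left β hα))

/-- **The printed form needs `β ≠ 0`**: for `α ≠ 0`, `α·0 + 0·α = 0 < α = α ⊕ 0`.
[cite: Clark2015EuclideanOrderTypes, §1.2 Prop. 4 (b) (upper bound: counterexample to the unrestricted form)] -/
theorem mul_add_mul_lt_nadd_zero {α : Ordinal.{u}} (hα : 0 < α) : α * 0 + 0 * α < nadd α 0 := by
  rw [mul_zero, zero_mul, add_zero, nadd_zero]
  exact hα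

/-- Prop. 4 (b) assembled for non-zero ordinals: `max(α + β, β + α) ≤ α ⊕ β ≤ αβ + βα`.
[cite: Clark2015EuclideanOrderTypes, §1.2 Prop. 4 (b)] -/
theorem max_add_le_nadd_and_nadd_le_mul_add_mul {α β : Ordinal.{u}} (hα : 0 < α) (hβ : 0 < β) :
    max (α + β) (β + α) ≤ nadd α β ∧ nadd α β ≤ α * β + β * α :=
  ⟨max_add_le_nadd α β, nadd_le_mul_add_mul hα hβ⟩

end Literature.Order.Ordinal
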